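import Summits.BirchSwinnertonDyer.BirchSwinnertonDyer.Theorems.PrintCf2RamifiedOffTYZCasselsTatePin
import Literature.NumberTheory.EllipticCurves.SecondDescentShaExponentProofs
import HarnessLib

/-!
# The Cassels–Tate PIN on the jump-one class, part 2: the congruent number curves (crux stmt-BirchSwinnertonDyer-20509
# `RamifiedOffTYZOfFacts`, line `offtyz-v7`, LEAD cruxlead-20509 g21, cycle 22) — structural lemma (E) of `cassels-tate-entries` (item 23431)

HONEST FRAMING (cell `bsd-print-cf2`, route `PrintCf2`; `--supports stmt-BirchSwinnertonDyer-20509`; `def`-free, no `sorry`; named facts enter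
only as HYPOTHESES: `casselsTate_pairing_levelKernel ℚ` (the typer's (U4) fact, p775107) where a dichotomy or the existence of the form is
claimed, and GZK `rank_eq_analyticRank_of_analyticRank_le_one` (conjunct 1 of `𝔅_ram`) in the last theorem). BSD is not proved by any of
this; no class is closed; 20509 / 23431 OPEN.

Part 1 (`PrintCf2RamifiedOffTYZCasselsTatePin.lean`, any elliptic curve over a number field): `[2]_* Sel₄ = π₂⁻¹(2·Ш[4])` = the
radical of any pairing on `Sel₂` with that left kernel; PIN (`Ш[4] = Ш[2]` ⟹ radical = Kummer image) and converse; ZERO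
(`C ≡ 0 ⟺ Ш[2] ≤ 2Ш[4]`); granted the CT fact, the DICHOTOMY `Ш[4] = Ш[2] ∨ Ш[2] ≤ 2Ш[4]` when `#Ш[2] = 4`.  This part: §0 the card's
(G)-engine «halving Bockstein» `ι_* ∘ κ_d = κ_n ∘ [m]` (fact-free, any field); §0′ the two regimes as `[2]_* Sel₄ = ker π₂` (index
`#Ш[2]`) / `= Sel₂`; §3 `E_n : y² = x³ − n²x`, `n` square-free, `rank E_n(ℚ) = 1`, `#Sel₂(E_n) = 2⁵` (category D, rank one):
`#Ш(E_n)[2] = 4`; `#Sel₄ = 2⁶ ⟺ Ш[4] = Ш[2]`; `#Sel₄ = 2⁸ ⟺ Ш[2] ≤ 2Ш[4]`; granted the CT fact **`#Sel₄(E_n) ∈ {2⁶, 2⁸}`** (the census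
G/B label is ONE bit); **the PIN** `pin_of_selmerFour` (`#Sel₄ = 2⁶` ⟹ radical of the CT form = `κ₂(E_n(ℚ))`, index `4`: «rank 2»);
`C ≡ 0 ⟺ #Sel₄ = 2⁸` («rank 0», `[2]_* Sel₄ = Sel₂`); and `exists_pinned_form_on_jumpOne_class` on the binders of item 23431 (GZK + CT fact).
So on the jump-one class the hypothesis `#Sel₄(E_n) = 2⁶` of C⁺ is consumed as «the Cassels–Tate form on `Sel₂(E_n)` is non-zero and its
radical is the Mordell–Weil image» (p770682: any proof of C⁺ must use `#Sel₄`). References: Cassels 1962 (Arithmetic IV); Milne *ADT* I §6;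
Morgan–Smith 2021 §1; Silverman *AEC* X §4 (Thm X.4.2); Heath-Brown 1994 §1 (the `2`-descent counts on `E_n`).
-/

noncomputable section

open scoped Classical

open WeierstrassCurve Literature.NumberTheory.EllipticCurves Literature.NumberTheory.GaloisRepresentations

set_option autoImplicit false

universe u

namespace Summit.BirchSwinnertonDyer.PrintCf2.CasselsTatePin

/-! ## §0 The (G)-engine of the card: the halving Bockstein `ι_* ∘ κ_d = κ_n ∘ [m]` (fact-free, any field) -/

section Bockstein

variable {K : Type u} [Field K] (W : WeierstrassCurve K)

/-- **`ι_* ∘ κ_d = κ_n ∘ [m]`** (`d·m = n`; the card's First lemma «HalvingBockstein» for `d = 2`, `n = 4`): for rational points with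
`m·Q = P`, the change-of-level map `ι_* : H¹(K, E[d]) → H¹(K, E[n])` (inclusion `E[d] ↪ E[n]`, `torsionH1OfDvd`) sends the level-`d`
Kummer class of `Q` to the level-`n` Kummer class of `P` — both are the class of `σ ↦ σR − R` for one root `R` (`dR = Q`, `nR = mQ = P`).
[cite: SilvermanAEC2009, VIII.§2 (the Kummer pairing; independence of the chosen root)] -/
theorem torsionH1OfDvd_kummerMapTorsion {d n : ℤ} (m : ℤ) (hmn : d * m = n)
    (hdivd : ∀ P : geomPoints W, ∃ Q : geomPoints W, d • Q = P)
    (hdivn : ∀ P : geomPoints W, ∃ Q : geomPoints W, n • Q = P)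
    (P Q : W.toAffine.Point) (hPQ : m • Q = P) :
    torsionH1OfDvd W (⟨m, hmn.symm⟩ : d ∣ n) (kummerMapTorsion W d hdivd Q) =
      kummerMapTorsion W n hdivn P := by
  set R := zsmulRoot W d hdivd Q with hR
  have hRQ : d • R = toGeomPoints W Q := zsmul_zsmulRoot W d hdivd Q
  have hRP : n • R = toGeomPoints W P := by
    rw [← hmn, mul_comm, mul_smul, hRQ, ← map_zsmul, hPQ]
  rw [kummerMapTorsion_apply W n, kummerMapTorsionFun_eq W n hdivn P R hRP, kummerMapTorsion_apply W d]
  change torsionH1OfDvd W _ (kummerClassTorsion W d R (zsmul_zsmulRoot_mem W d hdivd Q)) = _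
  unfold kummerClassTorsion torsionH1OfDvd
  rw [resH1Hom_id_oneCocycleClass]
  congr 1

/-- **The halving Bockstein at levels `2 ∣ 4`**: `ι_*(κ₂ Q) = κ₄(2Q)` — the shape in which the card reads «`P` is twice a point» on
`Sel₄`. [cite: SilvermanAEC2009, VIII.§2] -/
theorem torsionH1OfDvd_kummerMapTorsion_two_four
    (hdiv₂ : ∀ P : geomPoints W, ∃ Q : geomPoints W, (2 : ℤ) • Q = P)
    (hdiv₄ : ∀ P : geomPoints W, ∃ Q : geomPoints W, (4 : ℤ) • Q = P)
    (P Q : W.toAffine.Point) (hPQ : (2 : ℤ) • Q = P) :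
    torsionH1OfDvd W (⟨2, by norm_num⟩ : (2 : ℤ) ∣ 4) (kummerMapTorsion W 2 hdiv₂ Q) =
      kummerMapTorsion W 4 hdiv₄ P :=
  torsionH1OfDvd_kummerMapTorsion W 2 (by norm_num) hdiv₂ hdiv₄ P Q hPQ

variable [NumberField K]

/-- The same inside the Selmer groups: `Sel^(d) → Sel^(n)` (`selmerGroupOfDvd`) sends `κ_d(Q)` to `κ_n(mQ)`.
[cite: SilvermanAEC2009, VIII.§2 and Thm. X.4.2(a)] -/
theorem selmerGroupOfDvd_kummer {d n : ℤ} (m : ℤ) (hmn : d * m = n)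
    (hdivd : ∀ P : geomPoints W, ∃ Q : geomPoints W, d • Q = P)
    (hdivn : ∀ P : geomPoints W, ∃ Q : geomPoints W, n • Q = P)
    (P Q : W.toAffine.Point) (hPQ : m • Q = P) :
    selmerGroupOfDvd W (⟨m, hmn.symm⟩ : d ∣ n)
        ⟨kummerMapTorsion W d hdivd Q, kummerMapTorsion_mem_selmerGroup W d hdivd Q⟩ =
      ⟨kummerMapTorsion W n hdivn P, kummerMapTorsion_mem_selmerGroup W n hdivn P⟩ :=
  Subtype.ext (by
    rw [coe_selmerGroupOfDvd]
    exact torsionH1OfDvd_kummerMapTorsion W m hmn hdivd hdivn P Q hPQ)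

end Bockstein

/-! ## §0′ The two regimes as statements about `[2]_* Sel₄ ≤ Sel₂` (fact-free, any elliptic curve over a number field) -/

section Regimes

variable {K : Type u} [Field K] [NumberField K] (W : WeierstrassCurve K) [W.IsElliptic]

/-- **ZERO regime ⟹ `[2]_* Sel₄ = Sel₂`**: if every class of `Ш[2]` halves in `Ш[4]`, every `2`-Selmer class lifts to a `4`-Selmer
class (the radical of the Cassels–Tate form is everything). [cite: MilneADT2006, Ch. I §6 Lemma 6.17] [cite: SilvermanAEC2009, Thm. X.4.2(a)] -/
theorem range_selmerZSMul_two_eq_top_of_sha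
    (hdiv : ∀ x : W.sha, (2 : ℤ) • x = 0 → ∃ w : W.sha, (4 : ℤ) • w = 0 ∧ (2 : ℤ) • w = x) :
    (selmerZSMul W (d := 2) (n := 4) 2 four_dvd_two_mul_two).range = ⊤ := by
  rw [eq_top_iff]
  rintro s -
  rw [mem_range_selmerZSMul_two_iff]
  exact hdiv _ (zsmul_selmerToSha W 2 s)

/-- **PIN regime ⟹ `[2]_* Sel₄ = ker π₂`** (= the Kummer image): if `Ш[4] = Ш[2]`, a `2`-Selmer class lifts to a `4`-Selmer class iff
it dies in `Ш`. [cite: MilneADT2006, Ch. I §6 Lemma 6.17] [cite: SilvermanAEC2009, Thm. X.4.2(a)] -/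
theorem range_selmerZSMul_two_eq_ker_of_sha (hexp : ∀ w : W.sha, (4 : ℤ) • w = 0 → (2 : ℤ) • w = 0) :
    (selmerZSMul W (d := 2) (n := 4) 2 four_dvd_two_mul_two).range = (selmerToSha W 2).ker := by
  ext s
  rw [mem_range_selmerZSMul_two_iff, AddMonoidHom.mem_ker]
  constructor
  · rintro ⟨w, hw4, hw2⟩
    rw [← hw2]
    exact hexp w hw4
  · intro hs
    exact ⟨0, smul_zero _, by rw [smul_zero, hs]⟩

/-- **PIN regime ⟹ `[Sel₂ : [2]_* Sel₄] = #Ш[2]`**: the radical `ker π₂` has index `#Ш(E/K)[2]` (`π₂ : Sel₂ ↠ Ш[2]`), i.e. the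
Cassels–Tate form descends to a NON-DEGENERATE alternating form on a group of order `#Ш[2]` (its «rank»).
[cite: MilneADT2006, Ch. I §6 Thm. 6.13(a), Lemma 6.17] [cite: SilvermanAEC2009, Thm. X.4.2(a)] -/
theorem index_range_selmerZSMul_two_of_sha (hexp : ∀ w : W.sha, (4 : ℤ) • w = 0 → (2 : ℤ) • w = 0) :
    (selmerZSMul W (d := 2) (n := 4) 2 four_dvd_two_mul_two).range.index =
      Nat.card (AddSubgroup.torsionBy W.sha (2 : ℤ)) := by
  rw [range_selmerZSMul_two_eq_ker_of_sha W hexp]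
  let f : selmerGroup W 2 →+ AddSubgroup.torsionBy W.sha (2 : ℤ) := (selmerToSha W 2).codRestrict _
    fun s => (mem_sha_torsionBy_iff W 2 _).mpr (zsmul_selmerToSha W 2 s)
  have hker : (selmerToSha W 2).ker = f.ker := by
    ext s
    simp only [AddMonoidHom.mem_ker]
    exact ⟨fun h => Subtype.ext h, fun h => congrArg Subtype.val h⟩
  have hsurj : Function.Surjective f := by
    intro x
    obtain ⟨s, hs⟩ := exists_selmerToSha_eq W two_ne_zero (x : W.sha)
      ((mem_sha_torsionBy_iff W 2 _).mp x.2)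
    exact ⟨s, Subtype.ext hs⟩
  rw [hker, AddSubgroup.index_ker, AddMonoidHom.range_eq_top.mpr hsurj, AddSubgroup.card_top]

end Regimes

/-! ## §3 The congruent number curves: category D (`#Sel₂(E_n) = 2⁵`) of rank one -/

section CongruentNumber

variable {n : ℕ}

/-- **`#Ш(E_n)[2] = 4`** for square-free `n` with `rank E_n(ℚ) = 1` and `#Sel₂(E_n) = 2⁵` (the `2`-descent count: `2¹ · 4 · #Ш[2] = 2⁵`).
[cite: SilvermanAEC2009, Thm. X.4.2] [cite: HeathBrown1994SelmerCongruentII, §1] -/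
theorem natCard_sha_two_eq_four (hsq : Squarefree n) [(congruentNumberCurve n).IsElliptic]
    (hr : (congruentNumberCurve n).mordellWeilRank = 1)
    (h₂ : Nat.card ((congruentNumberCurve n).selmerGroup 2) = 2 ^ 5) :
    Nat.card (AddSubgroup.torsionBy (congruentNumberCurve n).sha (2 : ℤ)) = 4 := by
  have h' := (MonskySelmerParity.natCard_shaTorsionBy_two_eq_pow hsq.ne_zero (s := 3) h₂).2
  rw [hr] at h'
  simpa using h'

/-- **`#Sel₄(E_n) = 2⁶ ⟺ Ш(E_n)[4] = Ш(E_n)[2]`** on category D of rank one (fact-free): (⟹) the `4`-descent count gives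
`#Ш[4] = 4 = #Ш[2]` and `Ш[2] ≤ Ш[4]`; (⟸) `#Ш[4] = #Ш[2] = 4` and the count reads `#Sel₄ = 4 · 4 · 4`.
[cite: SilvermanAEC2009, Thm. X.4.2] [cite: HeathBrown1994SelmerCongruentII, §1] -/
theorem natCard_selmerGroup_four_eq_two_pow_six_iff (hsq : Squarefree n) [(congruentNumberCurve n).IsElliptic]
    (hr : (congruentNumberCurve n).mordellWeilRank = 1)
    (h₂ : Nat.card ((congruentNumberCurve n).selmerGroup 2) = 2 ^ 5) :
    Nat.card ((congruentNumberCurve n).selmerGroup 4) = 2 ^ 6 ↔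
      ∀ w : (congruentNumberCurve n).sha, (4 : ℤ) • w = 0 → (2 : ℤ) • w = 0 := by
  have hsha₂ := natCard_sha_two_eq_four hsq hr h₂
  haveI : Finite (AddSubgroup.torsionBy (congruentNumberCurve n).sha (2 : ℤ)) :=
    Nat.finite_of_card_ne_zero (by rw [hsha₂]; norm_num)
  have hle : AddSubgroup.torsionBy (congruentNumberCurve n).sha (2 : ℤ) ≤
      AddSubgroup.torsionBy (congruentNumberCurve n).sha (4 : ℤ) :=
    Submodule.torsionBy_le_torsionBy_of_dvd (2 : ℤ) 4 (by norm_num)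
  constructor
  · intro h₄ w hw
    have h := (natCard_shaTorsionBy_four_eq_pow hsq (s := 4) (by rw [h₄])).2
    rw [hr, show (2 : ℕ) ^ (4 - 2 * 1) = 4 by norm_num] at h
    -- `Ш[2] ≤ Ш[4]`, `#Ш[4] = 4 = #Ш[2]` ⇒ equal
    haveI : Finite (AddSubgroup.torsionBy (congruentNumberCurve n).sha (4 : ℤ)) :=
      Nat.finite_of_card_ne_zero (by rw [h]; norm_num)
    have heq := AddSubgroup.eq_of_le_of_card_ge hle (by rw [h, hsha₂])
    have hw' : w ∈ AddSubgroup.torsionBy (congruentNumberCurve n).sha (4 : ℤ) :=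
      (mem_sha_torsionBy_iff _ 4 w).mpr hw
    rw [← heq] at hw'
    exact (mem_sha_torsionBy_iff _ 2 w).mp hw'
  · intro hexp
    have heq : AddSubgroup.torsionBy (congruentNumberCurve n).sha (4 : ℤ) =
        AddSubgroup.torsionBy (congruentNumberCurve n).sha (2 : ℤ) :=
      le_antisymm (fun w hw => (mem_sha_torsionBy_iff _ 2 w).mpr
        (hexp w ((mem_sha_torsionBy_iff _ 4 w).mp hw))) hle
    have hsha₄ : Nat.card (AddSubgroup.torsionBy (congruentNumberCurve n).sha ((4 : ℕ) : ℤ)) = 4 := by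
      rw [Nat.cast_ofNat, heq, hsha₂]
    have hsel := (congruentNumberCurve n).natCard_selmerGroup_eq_of_natCard_eq four_ne_zero
      (t := 4) (c := 4) (by convert natCard_torsionBy_four_congruentNumberCurve hsq; norm_num) hsha₄
    rw [hr] at hsel
    simp only [Nat.cast_ofNat] at hsel
    rw [hsel]
    norm_num

/-- **`#Sel₄(E_n) = 2⁸ ⟺ Ш(E_n)[2] ≤ 2·Ш(E_n)[4]`** on category D of rank one (fact-free): with `g = 2· : Ш[4] → Ш[2]`,
`ker g = Ш[2]` has `4` elements, so `#Sel₄ = 4 · 4 · #Ш[4] = 2⁶ · #g(Ш[4])`, and `g` is onto iff `#g(Ш[4]) = 4`.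
[cite: SilvermanAEC2009, Thm. X.4.2] [cite: HeathBrown1994SelmerCongruentII, §1] -/
theorem natCard_selmerGroup_four_eq_two_pow_eight_iff (hsq : Squarefree n) [(congruentNumberCurve n).IsElliptic]
    (hr : (congruentNumberCurve n).mordellWeilRank = 1)
    (h₂ : Nat.card ((congruentNumberCurve n).selmerGroup 2) = 2 ^ 5) :
    Nat.card ((congruentNumberCurve n).selmerGroup 4) = 2 ^ 8 ↔
      ∀ x : (congruentNumberCurve n).sha, (2 : ℤ) • x = 0 →
        ∃ w : (congruentNumberCurve n).sha, (4 : ℤ) • w = 0 ∧ (2 : ℤ) • w = x := by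
  have hsha₂ := natCard_sha_two_eq_four hsq hr h₂
  haveI hfin2 : Finite (AddSubgroup.torsionBy (congruentNumberCurve n).sha (2 : ℤ)) :=
    Nat.finite_of_card_ne_zero (by rw [hsha₂]; norm_num)
  have hle : AddSubgroup.torsionBy (congruentNumberCurve n).sha (2 : ℤ) ≤
      AddSubgroup.torsionBy (congruentNumberCurve n).sha (4 : ℤ) :=
    Submodule.torsionBy_le_torsionBy_of_dvd (2 : ℤ) 4 (by norm_num)
  -- `g = 2· : Ш[4] → Ш[2]`
  let g : AddSubgroup.torsionBy (congruentNumberCurve n).sha (4 : ℤ) →+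
      AddSubgroup.torsionBy (congruentNumberCurve n).sha (2 : ℤ) :=
    ((zsmulAddGroupHom 2 : (congruentNumberCurve n).sha →+ (congruentNumberCurve n).sha).comp
      (AddSubgroup.torsionBy (congruentNumberCurve n).sha (4 : ℤ)).subtype).codRestrict _
      fun w => (mem_sha_torsionBy_iff _ 2 _).mpr (by
        change (2 : ℤ) • ((2 : ℤ) • (w : (congruentNumberCurve n).sha)) = 0
        rw [smul_smul]
        exact (mem_sha_torsionBy_iff _ 4 _).mp w.2)
  have hg : ∀ w, ((g w : AddSubgroup.torsionBy (congruentNumberCurve n).sha (2 : ℤ)) :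
      (congruentNumberCurve n).sha) = (2 : ℤ) • (w : (congruentNumberCurve n).sha) := fun w => rfl
  -- `ker g = Ш[2]` (inside `Ш[4]`), of order `4`
  have hker : g.ker = (AddSubgroup.torsionBy (congruentNumberCurve n).sha (2 : ℤ)).addSubgroupOf
      (AddSubgroup.torsionBy (congruentNumberCurve n).sha (4 : ℤ)) := by
    ext w
    rw [AddMonoidHom.mem_ker, AddSubgroup.mem_addSubgroupOf, mem_sha_torsionBy_iff, ← hg]
    exact ⟨fun h => congrArg Subtype.val h, fun h => Subtype.ext h⟩
  have hkcard : Nat.card g.ker = 4 := by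
    rw [hker, Nat.card_congr (AddSubgroup.addSubgroupOfEquivOfLe hle).toEquiv, hsha₂]
  -- `#Ш[4] = 4 · #range g`
  have hmul : 4 * Nat.card g.range =
      Nat.card (AddSubgroup.torsionBy (congruentNumberCurve n).sha (4 : ℤ)) := by
    rw [← hkcard, ← AddSubgroup.index_ker, AddSubgroup.card_mul_index]
  constructor
  · intro h₈ x hx
    -- `#Ш[4] = 16` (the `4`-descent count), so `#range g = 4 = #Ш[2]`: `g` is onto
    have h16 : Nat.card (AddSubgroup.torsionBy (congruentNumberCurve n).sha (4 : ℤ)) = 16 := by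
      have h := (natCard_shaTorsionBy_four_eq_pow hsq (s := 6) (by rw [h₈])).2
      rw [hr, show (2 : ℕ) ^ (6 - 2 * 1) = 16 by norm_num] at h
      exact h
    have hrange : Nat.card g.range =
        Nat.card (AddSubgroup.torsionBy (congruentNumberCurve n).sha (2 : ℤ)) := by
      rw [hsha₂]; omega
    have htop : g.range = ⊤ := AddSubgroup.eq_top_of_card_eq g.range hrange
    have hxmem : (⟨x, (mem_sha_torsionBy_iff _ 2 x).mpr hx⟩ :
        AddSubgroup.torsionBy (congruentNumberCurve n).sha (2 : ℤ)) ∈ g.range := by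
      rw [htop]; exact AddSubgroup.mem_top _
    obtain ⟨w, hw⟩ := hxmem
    exact ⟨(w : (congruentNumberCurve n).sha), (mem_sha_torsionBy_iff _ 4 _).mp w.2, by rw [← hg, hw]⟩
  · intro hdiv
    -- `g` onto, so `#range g = 4`, `#Ш[4] = 16`, `#Sel₄ = 4 · 4 · 16`
    have htop : g.range = ⊤ := by
      rw [eq_top_iff]
      rintro x -
      obtain ⟨w, hw4, hwx⟩ :=
        hdiv (x : (congruentNumberCurve n).sha) ((mem_sha_torsionBy_iff _ 2 _).mp x.2)
      exact ⟨⟨w, (mem_sha_torsionBy_iff _ 4 w).mpr hw4⟩, Subtype.ext (by rw [hg]; exact hwx)⟩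
    have hrange : Nat.card g.range = 4 := by rw [htop, AddSubgroup.card_top, hsha₂]
    have hsha₄ : Nat.card (AddSubgroup.torsionBy (congruentNumberCurve n).sha ((4 : ℕ) : ℤ)) = 16 := by
      rw [Nat.cast_ofNat]; omega
    have hsel := (congruentNumberCurve n).natCard_selmerGroup_eq_of_natCard_eq four_ne_zero
      (t := 4) (c := 16) (by convert natCard_torsionBy_four_congruentNumberCurve hsq; norm_num) hsha₄
    rw [hr] at hsel
    simp only [Nat.cast_ofNat] at hsel
    rw [hsel]
    norm_num

/-- **(E) THE DICHOTOMY ON CATEGORY D OF RANK ONE** (granted `casselsTate_pairing_levelKernel ℚ`): for square-free `n` with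
`rank E_n(ℚ) = 1` and `#Sel₂(E_n) = 2⁵`, **`#Sel₄(E_n) = 2⁶` or `#Sel₄(E_n) = 2⁸`** — the level-two bit of the `2`-descent is ONE bit
(the census labels G / B). [cite: MilneADT2006, Ch. I §6 Thm. 6.13(a), Lemma 6.17] [cite: Cassels1962ArithmeticIV] [cite: HeathBrown1994SelmerCongruentII, §1] -/
theorem natCard_selmerGroup_four_eq_or (hCT : casselsTate_pairing_levelKernel ℚ) (hsq : Squarefree n)
    [(congruentNumberCurve n).IsElliptic] (hr : (congruentNumberCurve n).mordellWeilRank = 1)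
    (h₂ : Nat.card ((congruentNumberCurve n).selmerGroup 2) = 2 ^ 5) :
    Nat.card ((congruentNumberCurve n).selmerGroup 4) = 2 ^ 6 ∨
      Nat.card ((congruentNumberCurve n).selmerGroup 4) = 2 ^ 8 := by
  rcases sha_dichotomy_of_natCard_sha_two_eq_four (congruentNumberCurve n) hCT
      (natCard_sha_two_eq_four hsq hr h₂) with hexp | hdiv
  · exact Or.inl ((natCard_selmerGroup_four_eq_two_pow_six_iff hsq hr h₂).mpr hexp)
  · exact Or.inr ((natCard_selmerGroup_four_eq_two_pow_eight_iff hsq hr h₂).mpr hdiv)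

variable {T : Type*} [AddCommGroup T]

/-- **(E) THE PIN ON THE JUMP-ONE CLASS** (fact-free given the pairing's kernel shape): for square-free `n` with `rank E_n(ℚ) = 1`,
`#Sel₂(E_n) = 2⁵` and `#Sel₄(E_n) = 2⁶`, and ANY pairing `C` on `Sel₂(E_n)` whose left kernel is `[2]_* Sel₄(E_n)` (the shape of
`exists_ctSelmer_two`), the radical of `C` is EXACTLY the Kummer image `κ₂(E_n(ℚ))` (`2³` classes: `E_n(ℚ)/2E_n(ℚ) ≅ (ℤ/2)³`) — the
Cassels–Tate form is non-zero on `Sel₂(E_n)/κ₂(E_n(ℚ)) = Ш(E_n)[2] ≅ (ℤ/2)²` and names the Mordell–Weil line without knowing a generator.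
[cite: MilneADT2006, Ch. I §6 Thm. 6.13(a), Lemma 6.17] [cite: MorganSmith2021CTP, Thm. 1.3 with Ex. 1.4] [cite: SilvermanAEC2009, Thm. X.4.2(a)] -/
theorem pin_of_selmerFour (hsq : Squarefree n) [(congruentNumberCurve n).IsElliptic]
    (hr : (congruentNumberCurve n).mordellWeilRank = 1)
    (h₂ : Nat.card ((congruentNumberCurve n).selmerGroup 2) = 2 ^ 5)
    (h₄ : Nat.card ((congruentNumberCurve n).selmerGroup 4) = 2 ^ 6)
    (C : selmerGroup (congruentNumberCurve n) 2 →+ selmerGroup (congruentNumberCurve n) 2 →+ T)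
    (hl : ∀ s, (∀ t, C s t = 0) ↔
      s ∈ (selmerZSMul (congruentNumberCurve n) (d := 2) (n := 4) 2 four_dvd_two_mul_two).range)
    (hdiv : ∀ P : geomPoints (congruentNumberCurve n), ∃ Q : geomPoints (congruentNumberCurve n), (2 : ℤ) • Q = P)
    (s : selmerGroup (congruentNumberCurve n) 2) :
    (∀ t, C s t = 0) ↔
      ∃ P : (congruentNumberCurve n).toAffine.Point,
        kummerMapTorsion (congruentNumberCurve n) 2 hdiv P = (s : galH1Torsion (congruentNumberCurve n) 2) :=
  forall_apply_eq_zero_iff_exists_kummer (congruentNumberCurve n) C hl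
    ((natCard_selmerGroup_four_eq_two_pow_six_iff hsq hr h₂).mp h₄) hdiv s

/-- **The ZERO regime**: for square-free `n` with `rank E_n(ℚ) = 1`, `#Sel₂(E_n) = 2⁵` and a pairing `C` on `Sel₂(E_n)` with left
kernel `[2]_* Sel₄(E_n)`: `C ≡ 0 ⟺ #Sel₄(E_n) = 2⁸` (the census B-label; then `Ш(E_n)[4] ⊋ Ш(E_n)[2]` or — outside rank one — rank 3).
[cite: MilneADT2006, Ch. I §6 Thm. 6.13(a), Lemma 6.17] [cite: MorganSmith2021CTP, Thm. 1.3 with Ex. 1.4] -/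
theorem forall_forall_apply_eq_zero_iff_selmerFour (hsq : Squarefree n) [(congruentNumberCurve n).IsElliptic]
    (hr : (congruentNumberCurve n).mordellWeilRank = 1)
    (h₂ : Nat.card ((congruentNumberCurve n).selmerGroup 2) = 2 ^ 5)
    (C : selmerGroup (congruentNumberCurve n) 2 →+ selmerGroup (congruentNumberCurve n) 2 →+ T)
    (hl : ∀ s, (∀ t, C s t = 0) ↔
      s ∈ (selmerZSMul (congruentNumberCurve n) (d := 2) (n := 4) 2 four_dvd_two_mul_two).range) :
    (∀ s t, C s t = 0) ↔ Nat.card ((congruentNumberCurve n).selmerGroup 4) = 2 ^ 8 :=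
  (forall_forall_apply_eq_zero_iff (congruentNumberCurve n) C hl).trans
    (natCard_selmerGroup_four_eq_two_pow_eight_iff hsq hr h₂).symm

/-- **The PIN regime characterised**: for square-free `n` with `rank E_n(ℚ) = 1`, `#Sel₂(E_n) = 2⁵` and a pairing `C` on `Sel₂(E_n)`
with left kernel `[2]_* Sel₄(E_n)`: the radical of `C` is `ker π₂` (= `κ₂(E_n(ℚ))`) **iff** `#Sel₄(E_n) = 2⁶`.
[cite: MilneADT2006, Ch. I §6 Thm. 6.13(a), Lemma 6.17] [cite: MorganSmith2021CTP, Thm. 1.3 with Ex. 1.4] -/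
theorem pin_iff_selmerFour (hsq : Squarefree n) [(congruentNumberCurve n).IsElliptic]
    (hr : (congruentNumberCurve n).mordellWeilRank = 1)
    (h₂ : Nat.card ((congruentNumberCurve n).selmerGroup 2) = 2 ^ 5)
    (C : selmerGroup (congruentNumberCurve n) 2 →+ selmerGroup (congruentNumberCurve n) 2 →+ T)
    (hl : ∀ s, (∀ t, C s t = 0) ↔
      s ∈ (selmerZSMul (congruentNumberCurve n) (d := 2) (n := 4) 2 four_dvd_two_mul_two).range) :
    (∀ s, (∀ t, C s t = 0) ↔ selmerToSha (congruentNumberCurve n) 2 s = 0) ↔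
      Nat.card ((congruentNumberCurve n).selmerGroup 4) = 2 ^ 6 := by
  rw [natCard_selmerGroup_four_eq_two_pow_six_iff hsq hr h₂]
  exact ⟨fun h => sha_four_le_two_of_pin (congruentNumberCurve n) C hl fun s => (h s).mp,
    fun hexp => forall_apply_eq_zero_iff_selmerToSha_eq_zero (congruentNumberCurve n) C hl hexp⟩

/-- **«Rank two» on the jump-one class**: for square-free `n` with `rank E_n(ℚ) = 1`, `#Sel₂(E_n) = 2⁵`, `#Sel₄(E_n) = 2⁶`, the
radical `[2]_* Sel₄(E_n)` of the Cassels–Tate form has index `4` in `Sel₂(E_n)`: the form descends to a non-degenerate alternating form on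
`Sel₂(E_n)/κ₂(E_n(ℚ)) = Ш(E_n)[2] ≅ (ℤ/2)²` (the card's «CT on `V ≅ 𝔽₂³` has rank `2`»). [cite: MilneADT2006, Ch. I §6 Thm. 6.13(a), Lemma 6.17]
[cite: HeathBrown1994SelmerCongruentII, §1] -/
theorem index_range_selmerZSMul_two_eq_four_of_selmerFour (hsq : Squarefree n) [(congruentNumberCurve n).IsElliptic]
    (hr : (congruentNumberCurve n).mordellWeilRank = 1)
    (h₂ : Nat.card ((congruentNumberCurve n).selmerGroup 2) = 2 ^ 5)
    (h₄ : Nat.card ((congruentNumberCurve n).selmerGroup 4) = 2 ^ 6) :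
    (selmerZSMul (congruentNumberCurve n) (d := 2) (n := 4) 2 four_dvd_two_mul_two).range.index = 4 := by
  rw [index_range_selmerZSMul_two_of_sha (congruentNumberCurve n)
    ((natCard_selmerGroup_four_eq_two_pow_six_iff hsq hr h₂).mp h₄), natCard_sha_two_eq_four hsq hr h₂]

/-- **«Rank zero» off the jump-one class**: for square-free `n` with `rank E_n(ℚ) = 1`, `#Sel₂(E_n) = 2⁵`, `#Sel₄(E_n) = 2⁸`, every
`2`-Selmer class lifts to a `4`-Selmer class: `[2]_* Sel₄(E_n) = Sel₂(E_n)`. [cite: MilneADT2006, Ch. I §6 Lemma 6.17] [cite: HeathBrown1994SelmerCongruentII, §1] -/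
theorem range_selmerZSMul_two_eq_top_of_selmerFour (hsq : Squarefree n) [(congruentNumberCurve n).IsElliptic]
    (hr : (congruentNumberCurve n).mordellWeilRank = 1)
    (h₂ : Nat.card ((congruentNumberCurve n).selmerGroup 2) = 2 ^ 5)
    (h₈ : Nat.card ((congruentNumberCurve n).selmerGroup 4) = 2 ^ 8) :
    (selmerZSMul (congruentNumberCurve n) (d := 2) (n := 4) 2 four_dvd_two_mul_two).range = ⊤ :=
  range_selmerZSMul_two_eq_top_of_sha (congruentNumberCurve n)
    ((natCard_selmerGroup_four_eq_two_pow_eight_iff hsq hr h₂).mp h₈)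

/-- **(E) ON THE C⁺ CLASS OF ITEM 23431, BY ITS BINDERS** (granted GZK = conjunct 1 of `𝔅_ram`, and the CT fact for the existence of
the form): for square-free `n` with `ord_{s=1} L(E_n, s) = 1`, `#Sel₂(E_n) = 2⁵`, `#Sel₄(E_n) = 2⁶` (the hypotheses of
`PrintCf2.RamifiedJumpOneLevelTwoOfFacts`; its residue condition `n ≡ 5, 6, 7 (mod 8)` is not needed here), there is an ALTERNATING
bi-additive form `C` on `Sel₂(E_n)` (the Cassels–Tate form of `exists_ctSelmer_two`) whose radical — on either side — is exactly the
Kummer image of `E_n(ℚ)`. This is the piece (E) of the line `cassels-tate-entries`: on C⁺'s class the level-two Selmer datum is a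
NON-ZERO alternating form on `Ш(E_n)[2] ≅ (ℤ/2)²` pinning the Mordell–Weil line. [cite: MilneADT2006, Ch. I §6 Thm. 6.13(a), Lemma 6.17]
[cite: MorganSmith2021CTP, Thm. 1.3 with Ex. 1.4] [cite: Cassels1962ArithmeticIV] -/
theorem exists_pinned_form_on_jumpOne_class (hGZK : rank_eq_analyticRank_of_analyticRank_le_one)
    (hCT : casselsTate_pairing_levelKernel ℚ) (hsq : Squarefree n) [(congruentNumberCurve n).IsElliptic]
    (hra : (congruentNumberCurve n).analyticRank = 1)
    (h₂ : Nat.card ((congruentNumberCurve n).selmerGroup 2) = 2 ^ 5)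
    (h₄ : Nat.card ((congruentNumberCurve n).selmerGroup 4) = 2 ^ 6)
    (hdiv : ∀ P : geomPoints (congruentNumberCurve n), ∃ Q : geomPoints (congruentNumberCurve n), (2 : ℤ) • Q = P) :
    ∃ C : selmerGroup (congruentNumberCurve n) 2 →+ selmerGroup (congruentNumberCurve n) 2 →+ AddCircle (1 : ℚ),
      (∀ s, C s s = 0) ∧
        (∀ s, (∀ t, C s t = 0) ↔ ∃ P : (congruentNumberCurve n).toAffine.Point,
          kummerMapTorsion (congruentNumberCurve n) 2 hdiv P = (s : galH1Torsion (congruentNumberCurve n) 2)) ∧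
        (∀ t, (∀ s, C s t = 0) ↔ ∃ P : (congruentNumberCurve n).toAffine.Point,
          kummerMapTorsion (congruentNumberCurve n) 2 hdiv P = (t : galH1Torsion (congruentNumberCurve n) 2)) := by
  have hr : (congruentNumberCurve n).mordellWeilRank = 1 :=
    ((hGZK (congruentNumberCurve n) hra.le).1).trans hra
  obtain ⟨C, halt, hl, hrt⟩ := exists_ctSelmer_two hCT (congruentNumberCurve n)
  have hexp := (natCard_selmerGroup_four_eq_two_pow_six_iff hsq hr h₂).mp h₄
  -- the right radical is the left radical of the flipped form, whose kernel shape is `hrt`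
  exact ⟨C, halt, pin_of_selmerFour hsq hr h₂ h₄ C hl hdiv,
    forall_apply_eq_zero_iff_exists_kummer (congruentNumberCurve n) C.flip hrt hexp hdiv⟩

end CongruentNumber

end Summit.BirchSwinnertonDyer.PrintCf2.CasselsTatePin

end
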